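import Literature.MathematicalPhysics.QuantumFieldTheory.Balaban1983to89.B4Eq19LatticeGradientExcessDecay
import Literature.MathematicalPhysics.QuantumFieldTheory.Balaban1983to89.B4Eq19LatticeDirichletZero
import Literature.MathematicalPhysics.QuantumFieldTheory.Balaban1983to89.B4Eq19CampanatoIterationSharp
import Literature.MathematicalPhysics.QuantumFieldTheory.Balaban1983to89.B4Eq19LatticeInteriorHolder

/-!
# `Balaban1983to89.B4Eq19LatticeGradientCampanato` — T. Bałaban, *Propagators and renormalization transformations for lattice gauge theories. II*,
# Commun. Math. Phys. **96** (1984) 223–250 [Balaban1984PropagatorsII] (1.9) p. 226, with *Propagators for lattice gauge theories in a background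
# field*, Commun. Math. Phys. **99** (1985) 389–434 [Balaban1985BackgroundPropagators] Thm 3.1 (3.43)₁∕(3.44) p. 398 (the GRADIENT members
# *«‖ζ∇_UG′(U)λ‖_β»*, *«|(∇_UG′(U)∇\*_Uλ)(x)|»*): **THE GRADIENT CAMPANATO ESTIMATE ON `ℤ^d`, UNIFORM IN THE SCALE** — for `(−Δ + K⁻²)u = ∂*g` on
# `Q_{4K}(a)` with `|u| ≤ M_u` and `g` `½`-HÖLDER AT SCALE `K` (`|g(y′) − g(y)| ≤ H√(s∕K)` for `y′ ∈ Q_s(y)`), the mean-square excess of every forward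
# difference decays with the exponent `d + 1 = d + 2·½` at every centre `x ∈ Q_K(a)`:
# `exc (∂_μu) (Q_ρ(x)) ≤ C_d·((M_u∕K)² + H²)∕K·(ρ+1)^{d+1}` (`0 ≤ ρ ≤ 2K`) — [Giaquinta1984] Ch. III §3 (Thm 3.1–3.2), discrete: comparison with the
# massless harmonic replacement (the mass term and the frozen datum `g − g(x)` are divergence-form data of size `O((r+1)∕K)` in energy), the gradient
# excess decay `B4Eq19LatticeGradientExcessDecay`, and the SHARP iteration lemma `B4Eq19CampanatoIterationSharp`.

statement-level skeleton of published theorems with citation tags; proofs where landed; nothing here is a claim about the Yang–Mills mass gap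

CITATION HEADER (lean-in-tree rule).  Audit cell `pub-balaban`, sub-cell `t4`, BINDER row NE9; filed by NE9 crux-team LEAF PROVER 01
(`b2b-balaban-t4-ne9-formalise-leaf-01`, gen 95; bears_on: R4/N22).  The CONTENT is [folklore] discrete elliptic regularity ([Giaquinta1984] Ch. III §3);
[Balaban1984PropagatorsII] (1.9) ∕ [Balaban1985BackgroundPropagators] (3.43)₁, (3.44) are the printed statements these files serve, nothing of them is asserted
here.  REUSED BY NAME: gen 94's `B4Eq19LatticeInteriorHolder.top_scale_bound`, `B4Eq19LatticeCaccioppoli.caccioppoli`; this lineage's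
`B4Eq19LatticeDirichletZero.exists_harmonic_replacement_zero`, `exists_antideriv`, `B4Eq19LatticeGradientExcessDecay.gradient_excess_decay`,
`B4Eq19CampanatoIterationSharp.campanato_iteration_sharp`, `B4Eq19LatticeBoxMeans` (`exc` and its API).

WHAT IS PROVED (sorry-free; proof lane — 0 `def`; [folklore]).
* §1 small identities (`dvg_add'`, `dvg_sub_const`, `lop_zero_eq_sub`, `sum_sq_fdiff_le_gradSq`).
* §2 **`gradient_campanato_step`** — for `x ∈ Q_K(a)`, `0 ≤ ρ ≤ r ≤ 2K`: `exc (∂_μu)(Q_ρ(x)) ≤ 4A₁((ρ+1)∕(r+1))^{d+2} exc (∂_μu)(Q_r(x)) + (4A₁+2)·150·5^d·d·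
  ((M_u∕K)² + H²)∕K·(r+1)^{d+1}` (on `Q_{r+2}(x)` the equation reads `−Δu = ∂*(g − g(x) + g₀)` with `g₀` the antiderivative of `−K⁻²u`; massless harmonic
  replacement; `gradient_excess_decay` for the harmonic part; the energy of the rest is `≤ Σ_{Q_{r+2}}|g − g(x) + g₀|²`).
* §3 `exc_campanato_hypothesis` — the real-variable form for `ψ(t) = exc (∂_μu)(Q_{⌊t⌋−1}(x))` on `[1, 2K+1]`.
* §4 **`exists_gradient_campanato_const`** — `∃ C_d ≥ 0`: for `K ≥ 3`, every such `u, g`, every `x ∈ Q_K(a)`, `μ`, `0 ≤ ρ ≤ 2K`: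
  `exc (fdiff μ u) x ρ ≤ C_d·(((M_u∕K)² + H²)∕K)·(ρ+1)^{d+1}` (`campanato_iteration_sharp` with `q = d+1`, the top scale by `top_scale_bound` for `g − g(a)`).
HONEST SCOPE.  [folklore] lattice analysis; constants crude; no estimate of print; NOT summit progress (cell pub-balaban: NE9 NOT PRINTED ∕ NOT PROVED; spine
PROVED 0∕9; finite T⁴ — NOT infinite volume, NOT mass gap, NOT BetaPertH, NOT Clay).  NEW file importing the four named modules.  Net new unproved facts: 0.
-/

noncomputable section

open scoped BigOperators
open Finset

namespace Literature.MathematicalPhysics.QuantumFieldTheory.Balaban1983to89.B4Eq19LatticeGradientCampanato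

open B4Eq19LatticeOperators B4Eq19LatticeCaccioppoli B4Eq19LatticeDirichletReplacement B4Eq19LatticeBoxMeans B4Eq19LatticeDirichletZero
  B4Eq19LatticeGradientExcessDecay B4Eq19CampanatoIterationSharp B4Eq19LatticeInteriorHolder

variable {d : ℕ}

/-! ## §1 Small identities -/

/-- `∂*` is additive. [folklore] [cite: Balaban1985BackgroundPropagators, (3.8) p.392] -/
theorem dvg_add' (g₁ g₂ : Zd d → Fin d → ℝ) (y : Zd d) : dvg (fun x μ => g₁ x μ + g₂ x μ) y = dvg g₁ y + dvg g₂ y := by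
  simp only [dvg_apply, ← Finset.sum_add_distrib]
  exact Finset.sum_congr rfl fun μ _ => by ring

/-- `∂*` kills bond fields that are constant in the site. [folklore] [cite: Balaban1985BackgroundPropagators, (3.8) p.392] -/
theorem dvg_sub_const (g : Zd d → Fin d → ℝ) (c : Fin d → ℝ) (y : Zd d) : dvg (fun x μ => g x μ - c μ) y = dvg g y := by
  simp only [dvg_apply]
  exact Finset.sum_congr rfl fun μ _ => by ring

/-- `−Δu = (−Δ+κ)u − κu`. [folklore] [cite: Giaquinta1984, Ch. III §2 p.77] -/
theorem lop_zero_eq_sub (κ : ℝ) (u : Zd d → ℝ) (y : Zd d) : lop 0 u y = lop κ u y - κ * u y := by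
  rw [lop_apply, lop_apply]; ring

/-- One direction of `gradSq`: `Σ_Q (∂_μw)² ≤ gradSq w Q`. [folklore] [cite: Giaquinta1984, Ch. III §2 p.77] -/
theorem sum_sq_fdiff_le_gradSq (w : Zd d → ℝ) (Q : Finset (Zd d)) (μ : Fin d) : ∑ y ∈ Q, fdiff μ w y ^ 2 ≤ gradSq w Q := by
  rw [gradSq_def]
  exact Finset.sum_le_sum fun y _ => Finset.single_le_sum (f := fun ν => fdiff ν w y ^ 2) (fun _ _ => sq_nonneg _) (Finset.mem_univ μ)

/-! ## §2 The comparison step -/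

/-- **THE COMPARISON STEP OF THE GRADIENT CAMPANATO ITERATION.**  Let `d ≥ 1`, `K ≥ 3`, `(−Δ+K⁻²)u = ∂*g` on `Q_{4K}(a)`, `|u| ≤ M_u` there, and let `g` be
`½`-Hölder at scale `K` on `Q_{4K}(a)`: `|g(y′,μ) − g(y,μ)| ≤ H√(s∕K)` whenever `y′ ∈ Q_s(y)`.  Then for `x ∈ Q_K(a)`, `0 ≤ ρ ≤ r ≤ 2K` and every `μ`:
`exc (∂_μu)(Q_ρ(x)) ≤ 4A₁((ρ+1)∕(r+1))^{d+2}·exc (∂_μu)(Q_r(x)) + (4A₁+2)·150·5^d·d·((M_u∕K)² + H²)∕K·(r+1)^{d+1}` (`A₁` of `gradient_excess_decay`).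
[folklore] [cite: Giaquinta1984, Ch. III §3 Thm 3.1–3.2 pp.84–88; Balaban1985BackgroundPropagators, Thm 3.1 (3.43)–(3.44) p.398] -/
theorem gradient_campanato_step (hd : 1 ≤ d) {K : ℕ} (hK : 3 ≤ K) (u : Zd d → ℝ) (g : Zd d → Fin d → ℝ) (a : Zd d) {Mu H : ℝ}
    (hEq : ∀ y ∈ box a (4 * K), lop (1 / (K : ℝ) ^ 2) u y = dvg g y)
    (hu : ∀ y ∈ box a (4 * K), |u y| ≤ Mu)
    (hg : ∀ (s : ℕ) (y y' : Zd d), y ∈ box a (4 * K) → y' ∈ box a (4 * K) → y' ∈ box y s → ∀ μ, |g y' μ - g y μ| ≤ H * Real.sqrt (s / K))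
    {x : Zd d} (hx : x ∈ box a K) (μ : Fin d) {ρ r : ℤ} (hρ : 0 ≤ ρ) (hρr : ρ ≤ r) (hr : r ≤ 2 * K) :
    exc (fdiff μ u) x ρ ≤
      4 * ((4 : ℝ) ^ d * d ^ 2 * (1 + 56 * d) ^ d * ((2 : ℝ) ^ d * (1 + 56 * d) ^ d * (8 * ((d : ℝ) + 1)) ^ (d + 1)) *
          (896 * d * (12 * (d : ℝ) + 8) ^ d) + (12 * (d : ℝ) + 8) ^ (d + 2)) * (((ρ : ℝ) + 1) / ((r : ℝ) + 1)) ^ (d + 2) * exc (fdiff μ u) x r +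
      (4 * ((4 : ℝ) ^ d * d ^ 2 * (1 + 56 * d) ^ d * ((2 : ℝ) ^ d * (1 + 56 * d) ^ d * (8 * ((d : ℝ) + 1)) ^ (d + 1)) *
          (896 * d * (12 * (d : ℝ) + 8) ^ d) + (12 * (d : ℝ) + 8) ^ (d + 2)) + 2) * (150 * 5 ^ d * d) *
        (((Mu / K) ^ 2 + H ^ 2) / K) * ((r : ℝ) + 1) ^ (d + 1) := by
  set A₁ : ℝ := (4 : ℝ) ^ d * d ^ 2 * (1 + 56 * d) ^ d * ((2 : ℝ) ^ d * (1 + 56 * d) ^ d * (8 * ((d : ℝ) + 1)) ^ (d + 1)) *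
          (896 * d * (12 * (d : ℝ) + 8) ^ d) + (12 * (d : ℝ) + 8) ^ (d + 2) with hA₁
  have hd0 : 0 < d := by omega
  have hdR : (0 : ℝ) ≤ d := Nat.cast_nonneg d
  have hA₁0 : 0 ≤ A₁ := by positivity
  have hK3 : (3 : ℝ) ≤ K := by exact_mod_cast hK
  have hK0 : (0 : ℝ) < K := by linarith
  have hKZ : (3 : ℤ) ≤ K := by exact_mod_cast hK
  have hr0 : 0 ≤ r := hρ.trans hρr
  have hρR : (0 : ℝ) ≤ ρ := by exact_mod_cast hρ
  have hrR : (ρ : ℝ) ≤ r := by exact_mod_cast hρr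
  have hr2K : (r : ℝ) ≤ 2 * K := by exact_mod_cast hr
  have hr1 : (0 : ℝ) < (r : ℝ) + 1 := by linarith
  -- geometry: `Q_{r+2}(x) ⊆ Q_{4K}(a)`
  have hxa : x ∈ box a (4 * K) := box_mono a (by linarith) hx
  have hsub : box x (r + 2) ⊆ box a (4 * K) := box_subset_box fun i => by have := (mem_box.1 hx) i; linarith
  -- the frozen datum and the antiderivative of the mass term on `Q_{r+2}(x)`
  have hf₀ : ∀ y ∈ box x (r + 2), |(-(1 / (K : ℝ) ^ 2 * u y))| ≤ Mu / (K : ℝ) ^ 2 := by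
    intro y hy
    rw [abs_neg, abs_mul, abs_of_pos (by positivity : (0 : ℝ) < 1 / (K : ℝ) ^ 2)]
    have := hu y (hsub hy)
    calc 1 / (K : ℝ) ^ 2 * |u y| ≤ 1 / (K : ℝ) ^ 2 * Mu := mul_le_mul_of_nonneg_left this (by positivity)
      _ = Mu / (K : ℝ) ^ 2 := by ring
  obtain ⟨g₀, hg₀eq, hg₀le⟩ := exists_antideriv hd0 (fun y => -(1 / (K : ℝ) ^ 2 * u y)) x (r + 2) hf₀
  set G : Zd d → Fin d → ℝ := fun y ν => (g y ν - g x ν) + g₀ y ν with hG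
  -- the massless equation on `Q_{r+2}(x)`
  have hEq0 : ∀ y ∈ box x (r + 2), lop 0 u y = dvg G y := by
    intro y hy
    rw [lop_zero_eq_sub (1 / (K : ℝ) ^ 2), hEq y (hsub hy), hG, dvg_add', dvg_sub_const, hg₀eq y hy]; ring
  -- the size of `G` on `Q_{r+2}(x)`
  have hGle : ∀ y ∈ box x (r + 2), ∀ ν, G y ν ^ 2 ≤ 2 * (H ^ 2 * (((r : ℝ) + 2) / K)) + 2 * ((2 * ((r : ℝ) + 2) + 1) * (Mu / (K : ℝ) ^ 2)) ^ 2 := by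
    intro y hy ν
    have h1 : |g y ν - g x ν| ≤ H * Real.sqrt (((r + 2).toNat : ℕ) / K) :=
      hg (r + 2).toNat x y hxa (hsub hy) (by rwa [Int.toNat_of_nonneg (by linarith)]) ν
    have hcast : (((r + 2).toNat : ℕ) : ℝ) = (r : ℝ) + 2 := by
      have : (((r + 2).toNat : ℕ) : ℤ) = r + 2 := Int.toNat_of_nonneg (by linarith)
      exact_mod_cast this
    rw [hcast] at h1
    have h2 : |g₀ y ν| ≤ (2 * ((r : ℝ) + 2) + 1) * (Mu / (K : ℝ) ^ 2) := by
      have := hg₀le y hy ν; push_cast at this; exact this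
    have h1sq : (g y ν - g x ν) ^ 2 ≤ H ^ 2 * (((r : ℝ) + 2) / K) := by
      have e : (H * Real.sqrt (((r : ℝ) + 2) / K)) ^ 2 = H ^ 2 * (((r : ℝ) + 2) / K) := by
        rw [mul_pow, Real.sq_sqrt (by positivity)]
      rw [← e, ← sq_abs]; exact pow_le_pow_left₀ (abs_nonneg _) h1 2
    have h2sq : g₀ y ν ^ 2 ≤ ((2 * ((r : ℝ) + 2) + 1) * (Mu / (K : ℝ) ^ 2)) ^ 2 := by
      rw [← sq_abs]; exact pow_le_pow_left₀ (abs_nonneg _) h2 2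
    calc G y ν ^ 2 = ((g y ν - g x ν) + g₀ y ν) ^ 2 := by rw [hG]
      _ ≤ 2 * (g y ν - g x ν) ^ 2 + 2 * g₀ y ν ^ 2 := by nlinarith [sq_nonneg ((g y ν - g x ν) - g₀ y ν)]
      _ ≤ 2 * (H ^ 2 * (((r : ℝ) + 2) / K)) + 2 * ((2 * ((r : ℝ) + 2) + 1) * (Mu / (K : ℝ) ^ 2)) ^ 2 := by linarith
  -- the energy of the data on `Q_{r+2}(x)` in the form `W := 150·5^d·d·((Mu/K)²+H²)/K·(r+1)^{d+1}`
  set W : ℝ := 150 * 5 ^ d * d * (((Mu / K) ^ 2 + H ^ 2) / K) * ((r : ℝ) + 1) ^ (d + 1) with hW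
  have hW0 : 0 ≤ W := by positivity
  have hdata : ∑ y ∈ box x (r + 2), ∑ ν, G y ν ^ 2 ≤ W := by
    have hcard : ((box x (r + 2)).card : ℝ) = ((2 * (r + 2) + 1 : ℤ) : ℝ) ^ d := card_box x (by linarith)
    have hpt : ∀ y ∈ box x (r + 2), ∑ ν, G y ν ^ 2 ≤ d * (2 * (H ^ 2 * (((r : ℝ) + 2) / K)) + 2 * ((2 * ((r : ℝ) + 2) + 1) * (Mu / (K : ℝ) ^ 2)) ^ 2) := by
      intro y hy
      calc ∑ ν, G y ν ^ 2 ≤ ∑ _ν : Fin d, (2 * (H ^ 2 * (((r : ℝ) + 2) / K)) + 2 * ((2 * ((r : ℝ) + 2) + 1) * (Mu / (K : ℝ) ^ 2)) ^ 2) :=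
            Finset.sum_le_sum fun ν _ => hGle y hy ν
        _ = _ := by rw [Finset.sum_const, Finset.card_univ, Fintype.card_fin, nsmul_eq_mul]
    have e1 : (2 * (H ^ 2 * (((r : ℝ) + 2) / K)) + 2 * ((2 * ((r : ℝ) + 2) + 1) * (Mu / (K : ℝ) ^ 2)) ^ 2) ≤
        (4 * H ^ 2 + 150 * (Mu / K) ^ 2) * ((r : ℝ) + 1) / K := by
      -- `(r+2) ≤ 2(r+1)`, `(2r+5)² ≤ 25(r+1)² ≤ 75 K (r+1)`
      have i1 : ((r : ℝ) + 2) / K ≤ 2 * ((r : ℝ) + 1) / K := by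
        apply div_le_div_of_nonneg_right _ hK0.le; linarith
      have i2 : (2 * ((r : ℝ) + 2) + 1) ^ 2 ≤ 75 * K * ((r : ℝ) + 1) := by nlinarith
      have i3 : ((2 * ((r : ℝ) + 2) + 1) * (Mu / (K : ℝ) ^ 2)) ^ 2 ≤ 75 * (Mu / K) ^ 2 * ((r : ℝ) + 1) / K := by
        rw [mul_pow]
        have hM2 : 0 ≤ (Mu / (K : ℝ) ^ 2) ^ 2 := sq_nonneg _
        calc (2 * ((r : ℝ) + 2) + 1) ^ 2 * (Mu / (K : ℝ) ^ 2) ^ 2 ≤ 75 * K * ((r : ℝ) + 1) * (Mu / (K : ℝ) ^ 2) ^ 2 :=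
              mul_le_mul_of_nonneg_right i2 hM2
          _ = 75 * (Mu / K) ^ 2 * ((r : ℝ) + 1) / K := by field_simp
      have hH2 : 0 ≤ H ^ 2 := sq_nonneg H
      calc 2 * (H ^ 2 * (((r : ℝ) + 2) / K)) + 2 * ((2 * ((r : ℝ) + 2) + 1) * (Mu / (K : ℝ) ^ 2)) ^ 2
          ≤ 2 * (H ^ 2 * (2 * ((r : ℝ) + 1) / K)) + 2 * (75 * (Mu / K) ^ 2 * ((r : ℝ) + 1) / K) :=
            add_le_add (mul_le_mul_of_nonneg_left (mul_le_mul_of_nonneg_left i1 hH2) (by norm_num)) (mul_le_mul_of_nonneg_left i3 (by norm_num))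
        _ = (4 * H ^ 2 + 150 * (Mu / K) ^ 2) * ((r : ℝ) + 1) / K := by ring
    have e2 : ((2 * (r + 2) + 1 : ℤ) : ℝ) ^ d ≤ 5 ^ d * ((r : ℝ) + 1) ^ d := by
      rw [← mul_pow]; apply pow_le_pow_left₀ (by push_cast; linarith); push_cast; linarith
    calc ∑ y ∈ box x (r + 2), ∑ ν, G y ν ^ 2
        ≤ ∑ y ∈ box x (r + 2), d * (2 * (H ^ 2 * (((r : ℝ) + 2) / K)) + 2 * ((2 * ((r : ℝ) + 2) + 1) * (Mu / (K : ℝ) ^ 2)) ^ 2) :=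
          Finset.sum_le_sum hpt
      _ = ((2 * (r + 2) + 1 : ℤ) : ℝ) ^ d * (d * (2 * (H ^ 2 * (((r : ℝ) + 2) / K)) + 2 * ((2 * ((r : ℝ) + 2) + 1) * (Mu / (K : ℝ) ^ 2)) ^ 2)) := by
          rw [Finset.sum_const, nsmul_eq_mul, hcard]
      _ ≤ (5 ^ d * ((r : ℝ) + 1) ^ d) * (d * ((4 * H ^ 2 + 150 * (Mu / K) ^ 2) * ((r : ℝ) + 1) / K)) :=
          mul_le_mul e2 (mul_le_mul_of_nonneg_left e1 hdR) (by positivity) (by positivity)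
      _ ≤ (5 ^ d * ((r : ℝ) + 1) ^ d) * (d * ((150 * H ^ 2 + 150 * (Mu / K) ^ 2) * ((r : ℝ) + 1) / K)) := by
          apply mul_le_mul_of_nonneg_left _ (by positivity)
          apply mul_le_mul_of_nonneg_left _ hdR
          apply div_le_div_of_nonneg_right _ hK0.le
          apply mul_le_mul_of_nonneg_right _ (by linarith)
          nlinarith [sq_nonneg H]
      _ = W := by rw [hW]; ring
  -- massless harmonic replacement on `Q_{r+1}(x)`
  obtain ⟨h, w, huhw, hw0, hh, hwE⟩ := exists_harmonic_replacement_zero hd0 u G x (r + 1) (fun y hy => hEq0 y (box_mono x (by linarith) hy))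
  have hwE' : ∀ Q : Finset (Zd d), gradSq w Q ≤ W := fun Q =>
    (hwE Q).trans (le_of_eq_of_le (by rw [show r + 1 + 1 = r + 2 by ring]) hdata)
  -- excess of `∂_μ u` vs `∂_μ h`
  have hfd : ∀ y, fdiff μ u y = fdiff μ h y + fdiff μ w y := fun y => by
    simp only [fdiff_apply, huhw]; ring
  have hfd' : ∀ y, fdiff μ h y = fdiff μ u y + (-(fdiff μ w y)) := fun y => by rw [hfd y]; ring
  have hexcw : ∀ s : ℤ, exc (fdiff μ w) x s ≤ W := fun s =>
    (exc_le_sum_sq _ x s).trans ((sum_sq_fdiff_le_gradSq w _ μ).trans (hwE' _))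
  have hexcw' : ∀ s : ℤ, exc (fun y => -(fdiff μ w y)) x s ≤ W := fun s =>
    (exc_le_sum_sq _ x s).trans (le_trans (by simp only [neg_sq]; exact le_rfl) ((sum_sq_fdiff_le_gradSq w _ μ).trans (hwE' _)))
  have hq0 : 0 ≤ ((ρ : ℝ) + 1) / ((r : ℝ) + 1) := by positivity
  have hq1 : (((ρ : ℝ) + 1) / ((r : ℝ) + 1)) ^ (d + 2) ≤ 1 := pow_le_one₀ hq0 (by rw [div_le_one hr1]; linarith)
  have hdec := gradient_excess_decay hρ hρr h hh μ
  rw [← hA₁] at hdec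
  have e_u : exc (fdiff μ u) x ρ = exc (fun y => fdiff μ h y + fdiff μ w y) x ρ := by
    congr 1; funext y; exact hfd y
  have e_h : exc (fdiff μ h) x r = exc (fun y => fdiff μ u y + (-(fdiff μ w y))) x r := by
    congr 1; funext y; exact hfd' y
  have hexc_h_r : exc (fdiff μ h) x r ≤ 2 * exc (fdiff μ u) x r + 2 * W := by
    rw [e_h]; exact (exc_add_le _ _ x r).trans (by linarith [hexcw' r])
  have hexc_u_ρ : exc (fdiff μ u) x ρ ≤ 2 * exc (fdiff μ h) x ρ + 2 * W := by
    rw [e_u]; exact (exc_add_le _ _ x ρ).trans (by linarith [hexcw ρ])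
  have hexcur : 0 ≤ exc (fdiff μ u) x r := exc_nonneg _ _ _
  calc exc (fdiff μ u) x ρ ≤ 2 * exc (fdiff μ h) x ρ + 2 * W := hexc_u_ρ
    _ ≤ 2 * (A₁ * (((ρ : ℝ) + 1) / ((r : ℝ) + 1)) ^ (d + 2) * exc (fdiff μ h) x r) + 2 * W := by linarith [hdec]
    _ ≤ 2 * (A₁ * (((ρ : ℝ) + 1) / ((r : ℝ) + 1)) ^ (d + 2) * (2 * exc (fdiff μ u) x r + 2 * W)) + 2 * W := by
        have := mul_le_mul_of_nonneg_left hexc_h_r (by positivity : (0 : ℝ) ≤ A₁ * (((ρ : ℝ) + 1) / ((r : ℝ) + 1)) ^ (d + 2))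
        linarith
    _ = 4 * A₁ * (((ρ : ℝ) + 1) / ((r : ℝ) + 1)) ^ (d + 2) * exc (fdiff μ u) x r +
          (4 * A₁ * (((ρ : ℝ) + 1) / ((r : ℝ) + 1)) ^ (d + 2) + 2) * W := by ring
    _ ≤ 4 * A₁ * (((ρ : ℝ) + 1) / ((r : ℝ) + 1)) ^ (d + 2) * exc (fdiff μ u) x r + (4 * A₁ + 2) * W := by
        have : 4 * A₁ * (((ρ : ℝ) + 1) / ((r : ℝ) + 1)) ^ (d + 2) ≤ 4 * A₁ := by
          have := mul_le_mul_of_nonneg_left hq1 (by positivity : (0:ℝ) ≤ 4 * A₁); linarith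
        have := mul_le_mul_of_nonneg_right (add_le_add_right this 2) hW0
        linarith
    _ = 4 * A₁ * (((ρ : ℝ) + 1) / ((r : ℝ) + 1)) ^ (d + 2) * exc (fdiff μ u) x r +
          (4 * A₁ + 2) * (150 * 5 ^ d * d) * (((Mu / K) ^ 2 + H ^ 2) / K) * ((r : ℝ) + 1) ^ (d + 1) := by rw [hW]; ring

/-! ## §3 The real-variable Campanato hypothesis -/

/-- **The real-variable hypothesis** for `ψ(t) = exc (∂_μu)(Q_{⌊t⌋−1}(x))`: from the integer-radius step
`exc_ρ ≤ 4A₁((ρ+1)∕(r+1))^{d+2} exc_r + B(r+1)^{d+1}` (`0 ≤ ρ ≤ r ≤ 2K`) to `ψ(P) ≤ (4·2^{d+2}A₁)(P∕R)^{d+2}ψ(R) + B R^{d+1}` (`1 ≤ P ≤ R ≤ 2K+1`;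
`⌊P⌋∕⌊R⌋ ≤ 2P∕R`, `⌊R⌋ ≤ R`). [folklore] [cite: Giaquinta1984, Ch. III Lemma 2.1 p.86] -/
theorem exc_campanato_hypothesis (f : Zd d → ℝ) (x : Zd d) {K : ℕ} {A₁ B : ℝ} (hA₁ : 0 ≤ A₁) (hB : 0 ≤ B)
    (hstep : ∀ ρ r : ℤ, 0 ≤ ρ → ρ ≤ r → r ≤ 2 * K →
      exc f x ρ ≤ 4 * A₁ * (((ρ : ℝ) + 1) / ((r : ℝ) + 1)) ^ (d + 2) * exc f x r + B * ((r : ℝ) + 1) ^ (d + 1)) :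
    ∀ P R : ℝ, 1 ≤ P → P ≤ R → R ≤ 2 * (K : ℝ) + 1 →
      exc f x (⌊P⌋ - 1) ≤ (4 * 2 ^ (d + 2) * A₁) * (P / R) ^ (d + 2) * exc f x (⌊R⌋ - 1) + B * R ^ (d + 1) := by
  intro P R hP hPR hR
  have hfP : (1 : ℤ) ≤ ⌊P⌋ := by have := Int.floor_le_floor hP; rwa [Int.floor_one] at this
  have hfPR : ⌊P⌋ ≤ ⌊R⌋ := Int.floor_le_floor hPR
  have hfR : ⌊R⌋ ≤ 2 * (K : ℤ) + 1 := by
    have := Int.floor_le_floor hR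
    rwa [show (2 * (K : ℝ) + 1) = ((2 * (K : ℤ) + 1 : ℤ) : ℝ) by push_cast; ring, Int.floor_intCast] at this
  have h := hstep (⌊P⌋ - 1) (⌊R⌋ - 1) (by linarith) (by linarith) (by linarith)
  have e1 : (((⌊P⌋ - 1 : ℤ) : ℝ) + 1) = (⌊P⌋ : ℝ) := by push_cast; ring
  have e2 : (((⌊R⌋ - 1 : ℤ) : ℝ) + 1) = (⌊R⌋ : ℝ) := by push_cast; ring
  rw [e1, e2] at h
  have hfR1 : (1 : ℝ) ≤ (⌊R⌋ : ℝ) := by have : (1:ℤ) ≤ ⌊R⌋ := hfP.trans hfPR; exact_mod_cast this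
  have hfRpos : (0 : ℝ) < (⌊R⌋ : ℝ) := by linarith
  have hR0 : 0 < R := by linarith
  have hratio : (⌊P⌋ : ℝ) / (⌊R⌋ : ℝ) ≤ 2 * (P / R) := by
    rw [div_le_iff₀ hfRpos]
    have h2 : R < (⌊R⌋ : ℝ) + 1 := Int.lt_floor_add_one R
    calc (⌊P⌋ : ℝ) ≤ P := Int.floor_le P
      _ = (P / R) * R := by field_simp
      _ ≤ (P / R) * (2 * (⌊R⌋ : ℝ)) := mul_le_mul_of_nonneg_left (by linarith) (by positivity)
      _ = 2 * (P / R) * (⌊R⌋ : ℝ) := by ring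
  have hratio_d : ((⌊P⌋ : ℝ) / (⌊R⌋ : ℝ)) ^ (d + 2) ≤ 2 ^ (d + 2) * (P / R) ^ (d + 2) := by
    rw [← mul_pow]; exact pow_le_pow_left₀ (by positivity) hratio (d + 2)
  have hRd : (⌊R⌋ : ℝ) ^ (d + 1) ≤ R ^ (d + 1) := pow_le_pow_left₀ hfRpos.le (Int.floor_le R) (d + 1)
  have hψR0 : 0 ≤ exc f x (⌊R⌋ - 1) := exc_nonneg _ _ _
  calc exc f x (⌊P⌋ - 1) ≤ 4 * A₁ * ((⌊P⌋ : ℝ) / (⌊R⌋ : ℝ)) ^ (d + 2) * exc f x (⌊R⌋ - 1) + B * (⌊R⌋ : ℝ) ^ (d + 1) := h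
    _ ≤ 4 * A₁ * (2 ^ (d + 2) * (P / R) ^ (d + 2)) * exc f x (⌊R⌋ - 1) + B * R ^ (d + 1) := by
        have t1 := mul_le_mul_of_nonneg_left hratio_d (by positivity : (0:ℝ) ≤ 4 * A₁)
        have t2 := mul_le_mul_of_nonneg_right t1 hψR0
        have t3 := mul_le_mul_of_nonneg_left hRd hB
        exact add_le_add t2 t3
    _ = (4 * 2 ^ (d + 2) * A₁) * (P / R) ^ (d + 2) * exc f x (⌊R⌋ - 1) + B * R ^ (d + 1) := by ring

/-! ## §4 The gradient Campanato estimate -/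

/-- **THE GRADIENT CAMPANATO ESTIMATE ON `ℤ^d`, UNIFORM IN THE SCALE.**  There is `C_d ≥ 0` (depending only on `d ≥ 1`) such that for every `K ≥ 3`, every `u, g`
with `(−Δ + K⁻²)u = ∂*g` and `|u| ≤ M_u` on `Q_{4K}(a)`, `g` `½`-Hölder at scale `K` on `Q_{4K}(a)` with constant `H` (`|g(y′,μ) − g(y,μ)| ≤ H√(s∕K)` for
`y′ ∈ Q_s(y)`), every centre `x ∈ Q_K(a)`, direction `μ` and `0 ≤ ρ ≤ 2K`:
`exc (∂_μu)(Q_ρ(x)) ≤ C_d·(((M_u∕K)² + H²)∕K)·(ρ+1)^{d+1}` — Campanato's characterisation of `∂_μu ∈ C^{½}` at scale `K` with constant `≍ (M_u∕K + H)`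
(`gradient_campanato_step` ⇒ `exc_campanato_hypothesis` ⇒ `campanato_iteration_sharp` (`q = d+1`); top scale by `top_scale_bound` for `g − g(a)`, `|g − g(a)| ≤ 2H`).
[folklore] [cite: Giaquinta1984, Ch. III §3 Thm 3.1–3.2 pp.84–88, §1 Thm 1.2 p.70; Balaban1985BackgroundPropagators, Thm 3.1 (3.43)–(3.44) p.398] -/
theorem exists_gradient_campanato_const (d : ℕ) (hd : 1 ≤ d) : ∃ C : ℝ, 0 ≤ C ∧
    ∀ (K : ℕ), 3 ≤ K → ∀ (u : Zd d → ℝ) (g : Zd d → Fin d → ℝ) (a : Zd d) (Mu H : ℝ), 0 ≤ Mu → 0 ≤ H →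
      (∀ y ∈ box a (4 * K), lop (1 / (K : ℝ) ^ 2) u y = dvg g y) →
      (∀ y ∈ box a (4 * K), |u y| ≤ Mu) →
      (∀ (s : ℕ) (y y' : Zd d), y ∈ box a (4 * K) → y' ∈ box a (4 * K) → y' ∈ box y s → ∀ μ, |g y' μ - g y μ| ≤ H * Real.sqrt (s / K)) →
      ∀ x ∈ box a (K : ℤ), ∀ (μ : Fin d) (ρ : ℤ), 0 ≤ ρ → ρ ≤ 2 * K →
        exc (fdiff μ u) x ρ ≤ C * (((Mu / K) ^ 2 + H ^ 2) / K) * ((ρ : ℝ) + 1) ^ (d + 1) := by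
  set A₁ : ℝ := (4 : ℝ) ^ d * d ^ 2 * (1 + 56 * d) ^ d * ((2 : ℝ) ^ d * (1 + 56 * d) ^ d * (8 * ((d : ℝ) + 1)) ^ (d + 1)) *
          (896 * d * (12 * (d : ℝ) + 8) ^ d) + (12 * (d : ℝ) + 8) ^ (d + 2) with hA₁
  have hdR : (0 : ℝ) ≤ d := Nat.cast_nonneg d
  have h66 : (4 : ℝ) * d * 6 ^ d * 4 ≤ 126 * d * 7 ^ d := by
    have h7 : (6 : ℝ) ^ d ≤ 7 ^ d := pow_le_pow_left₀ (by norm_num) (by norm_num) d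
    have h7' : (0 : ℝ) ≤ d * 7 ^ d := by positivity
    calc (4 : ℝ) * d * 6 ^ d * 4 = 16 * (d * 6 ^ d) := by ring
      _ ≤ 16 * (d * 7 ^ d) := mul_le_mul_of_nonneg_left (mul_le_mul_of_nonneg_left h7 hdR) (by norm_num)
      _ ≤ 126 * (d * 7 ^ d) := mul_le_mul_of_nonneg_right (by norm_num) h7'
      _ = 126 * d * 7 ^ d := by ring
  have hA₁0 : 0 ≤ A₁ := by positivity
  have hA₁1 : 1 ≤ A₁ := by
    rw [hA₁]
    have h1 : (1 : ℝ) ≤ (12 * (d : ℝ) + 8) ^ (d + 2) := one_le_pow₀ (by linarith)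
    have h2 : (0 : ℝ) ≤ (4 : ℝ) ^ d * d ^ 2 * (1 + 56 * d) ^ d * ((2 : ℝ) ^ d * (1 + 56 * d) ^ d * (8 * ((d : ℝ) + 1)) ^ (d + 1)) *
          (896 * d * (12 * (d : ℝ) + 8) ^ d) := by positivity
    linarith
  set A : ℝ := 4 * 2 ^ (d + 2) * A₁ with hA
  have hA1 : 1 ≤ A := by
    rw [hA]; exact one_le_mul_of_one_le_of_one_le (one_le_mul_of_one_le_of_one_le (by norm_num) (one_le_pow₀ (by norm_num))) hA₁1
  set D₀ : ℝ := (4 * A₁ + 2) * (150 * 5 ^ d * d) with hD₀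
  have hD₀0 : 0 ≤ D₀ := by positivity
  -- the constant
  set C : ℝ := (4 * A) ^ (d + 1) * (126 * d * 7 ^ d) + 4 / 3 * (4 * A) ^ (2 * (d + 1)) * D₀ with hC
  refine ⟨C, by positivity, ?_⟩
  intro K hK u g a Mu H hMu hH hEq hu hg x hx μ ρ hρ hρK
  have hK3 : (3 : ℝ) ≤ K := by exact_mod_cast hK
  have hK0 : (0 : ℝ) < K := by linarith
  -- the data size `E := ((Mu/K)² + H²)/K` and the junk constant `B := D₀ E`
  set E : ℝ := ((Mu / K) ^ 2 + H ^ 2) / K with hE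
  have hE0 : 0 ≤ E := by positivity
  set B : ℝ := D₀ * E with hB
  have hB0 : 0 ≤ B := by positivity
  -- the integer-radius step at the centre `x`
  have hstep : ∀ ρ' r : ℤ, 0 ≤ ρ' → ρ' ≤ r → r ≤ 2 * K →
      exc (fdiff μ u) x ρ' ≤ 4 * A₁ * (((ρ' : ℝ) + 1) / ((r : ℝ) + 1)) ^ (d + 2) * exc (fdiff μ u) x r + B * ((r : ℝ) + 1) ^ (d + 1) := by
    intro ρ' r h1 h2 h3
    have h := gradient_campanato_step hd hK u g a hEq hu hg hx μ h1 h2 h3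
    rw [← hA₁] at h
    rw [hB, hD₀, hE]
    linarith
  -- Campanato's iteration for `ψ(t) = exc (∂_μ u)(Q_{⌊t⌋-1}(x))` on `[1, 2K+1]`
  have hiter := campanato_iteration_sharp (ψ := fun t => exc (fdiff μ u) x (⌊t⌋ - 1)) (R₀ := 2 * (K : ℝ) + 1) (q := d + 1) hA1 hB0
    (fun t _ _ => exc_nonneg _ _ _) (fun s t _ hst _ => exc_mono _ x (by linarith [Int.floor_le_floor hst]))
    (by
      intro P R hP hPR hR
      have := exc_campanato_hypothesis (fdiff μ u) x hA₁0 hB0 hstep P R hP hPR hR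
      rw [← hA] at this
      exact this)
  -- evaluate at `R = 2K+1`, `P = ρ + 1`
  have hρR : (0 : ℝ) ≤ ρ := by exact_mod_cast hρ
  have hρKR : (ρ : ℝ) ≤ 2 * K := by exact_mod_cast hρK
  have hmain := hiter ((ρ : ℝ) + 1) (2 * (K : ℝ) + 1) (by linarith) (by linarith) le_rfl
  have eP : ⌊(ρ : ℝ) + 1⌋ - 1 = ρ := by
    rw [show (ρ : ℝ) + 1 = ((ρ + 1 : ℤ) : ℝ) by push_cast; ring, Int.floor_intCast]; ring
  have eR : ⌊2 * (K : ℝ) + 1⌋ - 1 = 2 * (K : ℤ) := by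
    rw [show 2 * (K : ℝ) + 1 = ((2 * (K : ℤ) + 1 : ℤ) : ℝ) by push_cast; ring, Int.floor_intCast]; ring
  simp only [eP, eR] at hmain
  -- the top scale: `exc ≤ gradSq u (Q_{2K}(x)) ≤ 126 d 7^d K^{d-2} Mu² + 4 d 6^d K^{d-2} (2KH)²`
  have hga : ∀ y ∈ box a (4 * K), ∀ ν, |g y ν - g a ν| ≤ 2 * H := by
    intro y hy ν
    have h := hg (4 * K) a y (self_mem_box a (by positivity)) hy (by exact_mod_cast hy) ν
    have hs : Real.sqrt (((4 * K : ℕ) : ℝ) / K) = 2 := by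
      rw [show (((4 * K : ℕ) : ℝ) / K) = 4 by push_cast; field_simp]
      rw [show (4 : ℝ) = 2 ^ 2 by norm_num, Real.sqrt_sq (by norm_num)]
    rw [hs] at h; linarith
  have hEq' : ∀ y ∈ box a (4 * K), lop (1 / (K : ℝ) ^ 2) u y = dvg (fun z ν => g z ν - g a ν) y := fun y hy => by
    rw [dvg_sub_const]; exact hEq y hy
  have hTop := top_scale_bound hK u (fun z ν => g z ν - g a ν) a hEq' hu hga hx
  have htop : exc (fdiff μ u) x (2 * K) ≤ (126 * d * 7 ^ d) * ((K : ℝ) ^ (d + 1) * E) := by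
    have h1 : exc (fdiff μ u) x (2 * K) ≤ gradSq u (box x (2 * K)) :=
      (exc_le_sum_sq _ x _).trans (sum_sq_fdiff_le_gradSq u _ μ)
    refine h1.trans (hTop.trans ?_)
    -- `126d7^d K^{d-2}Mu² + 4d6^d K^{d-2}(2KH)² ≤ 126d7^d K^{d+1} E`
    have e : 126 * d * 7 ^ d * ((K : ℝ) ^ d / (K : ℝ) ^ 2) * Mu ^ 2 + 4 * d * 6 ^ d * ((K : ℝ) ^ d / (K : ℝ) ^ 2) * ((K : ℝ) * (2 * H)) ^ 2 =
        126 * d * 7 ^ d * ((K : ℝ) ^ (d + 1) * ((Mu / K) ^ 2 / K)) + 4 * d * 6 ^ d * (4 * ((K : ℝ) ^ (d + 1) * (H ^ 2 / K))) := by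
      field_simp; ring
    rw [e]
    have hx1 : 0 ≤ (K : ℝ) ^ (d + 1) * ((Mu / K) ^ 2 / K) := by positivity
    have hx2 : 0 ≤ (K : ℝ) ^ (d + 1) * (H ^ 2 / K) := by positivity
    calc 126 * d * 7 ^ d * ((K : ℝ) ^ (d + 1) * ((Mu / K) ^ 2 / K)) + 4 * d * 6 ^ d * (4 * ((K : ℝ) ^ (d + 1) * (H ^ 2 / K)))
        = 126 * d * 7 ^ d * ((K : ℝ) ^ (d + 1) * ((Mu / K) ^ 2 / K)) + (4 * d * 6 ^ d * 4) * ((K : ℝ) ^ (d + 1) * (H ^ 2 / K)) := by ring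
      _ ≤ 126 * d * 7 ^ d * ((K : ℝ) ^ (d + 1) * ((Mu / K) ^ 2 / K)) + (126 * d * 7 ^ d) * ((K : ℝ) ^ (d + 1) * (H ^ 2 / K)) :=
          add_le_add_right (mul_le_mul_of_nonneg_right h66 hx2) _
      _ = 126 * d * 7 ^ d * ((K : ℝ) ^ (d + 1) * E) := by rw [hE]; ring
  -- `(P/(2K+1))^{d+1} K^{d+1} ≤ P^{d+1}`
  have hscale : (((ρ : ℝ) + 1) / (2 * (K : ℝ) + 1)) ^ (d + 1) * (K : ℝ) ^ (d + 1) ≤ ((ρ : ℝ) + 1) ^ (d + 1) := by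
    rw [div_pow, div_mul_eq_mul_div, div_le_iff₀ (by positivity)]
    exact mul_le_mul_of_nonneg_left (pow_le_pow_left₀ hK0.le (by linarith) _) (by positivity)
  have hP0 : 0 ≤ ((ρ : ℝ) + 1) ^ (d + 1) := by positivity
  calc exc (fdiff μ u) x ρ
      ≤ (4 * A) ^ (d + 1) * (((ρ : ℝ) + 1) / (2 * (K : ℝ) + 1)) ^ (d + 1) * exc (fdiff μ u) x (2 * K) +
          4 / 3 * (4 * A) ^ (2 * (d + 1)) * B * ((ρ : ℝ) + 1) ^ (d + 1) := hmain
    _ ≤ (4 * A) ^ (d + 1) * (((ρ : ℝ) + 1) / (2 * (K : ℝ) + 1)) ^ (d + 1) * ((126 * d * 7 ^ d) * ((K : ℝ) ^ (d + 1) * E)) +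
          4 / 3 * (4 * A) ^ (2 * (d + 1)) * B * ((ρ : ℝ) + 1) ^ (d + 1) := by
        have := mul_le_mul_of_nonneg_left htop (by positivity : (0:ℝ) ≤ (4 * A) ^ (d + 1) * (((ρ : ℝ) + 1) / (2 * (K : ℝ) + 1)) ^ (d + 1))
        linarith
    _ = (4 * A) ^ (d + 1) * (126 * d * 7 ^ d) * E * ((((ρ : ℝ) + 1) / (2 * (K : ℝ) + 1)) ^ (d + 1) * (K : ℝ) ^ (d + 1)) +
          4 / 3 * (4 * A) ^ (2 * (d + 1)) * D₀ * E * ((ρ : ℝ) + 1) ^ (d + 1) := by rw [hB]; ring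
    _ ≤ (4 * A) ^ (d + 1) * (126 * d * 7 ^ d) * E * ((ρ : ℝ) + 1) ^ (d + 1) +
          4 / 3 * (4 * A) ^ (2 * (d + 1)) * D₀ * E * ((ρ : ℝ) + 1) ^ (d + 1) := by
        have := mul_le_mul_of_nonneg_left hscale (by positivity : (0:ℝ) ≤ (4 * A) ^ (d + 1) * (126 * d * 7 ^ d) * E)
        linarith
    _ = C * E * ((ρ : ℝ) + 1) ^ (d + 1) := by rw [hC]; ring

end Literature.MathematicalPhysics.QuantumFieldTheory.Balaban1983to89.B4Eq19LatticeGradientCampanato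

end
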